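import Summits.QuantumFields.BalabanUV.InfraRed.StrongCouplingFluxLambda
import Summits.QuantumFields.BalabanUV.InfraRed.StrongCouplingLipschitzFlux
import Summits.QuantumFields.BalabanUV.InfraRed.StrongCouplingBallCertificate
import Summits.QuantumFields.BalabanUV.InfraRed.StrongCouplingQuarterCovariance
import HarnessLib

/-!
# Strong-coupling front, J-SC16k (part 3/3): `QuarterCovariance` — the one-link covariance bound
`|Cov_{ν_B}(φ, 2 Re tr(· Δ))| ≤ L ‖Δ‖_F` on the whole single-site Dobrushin ball `‖B‖_op ≤ 1/3` — PROVED, and the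
hypothesis-free strong-coupling doors at Wilson `0 ≤ β_W < 2/9` —
observatory of the non-perturbative crossover; no mass-gap claim

IR-3 v2 TWO-FRONT CROSSOVER LEDGER, front SC (`β₀`), SU(2), `d = 4`, Wilson normalisation `β_W = 4/g²`.
ABSOLUTE RULE of this package: No internally-minted statement may enter as a cited fact. Every hypothesis is either
kernel-proved in this package or a verbatim quotation of a PUBLISHED theorem with page reference. The manuscript(s)
under audit are NOT citable for their own disputed steps — they are the thing under adjudication; programme-internal
(2001/route/tribunal) claims are never citable.  Nothing is cited here: every statement below is [folklore] calculus,
kernel-proved.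

## What this file is

Leaf (22), the last leaf of the kernel port of FRONT-SC §3n: it closes the tree's typed open node
`StrongCouplingQuarterCovariance.QuarterCovariance` (the `@[conjecture] def` of that file; its `B`-axis-free half is
that file's `cov_pot_le_of_transverse`).
* `flux_bound` — the analytic inequality `|p|·Y + X ≤ (Z/4)·n` for `0 < κ ≤ 4/3`, `Re d′ = 0`, `‖d′‖² + p² = n²`:
  from leaf (21)'s λ-bounds, leaf (20)'s expansions `H_expand`/`Q_expand`, the eleven-moment certificate
  `ball_certificate` and the rational brackets of leaf (18), and leaf (17)'s `le_sqrt_mul_sqrt_of_forall`,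
  `add_mul_le_of_cert`.  Every load-bearing rational constant of the certificate has two implementations (exact
  rational arithmetic in `bracket_design.py` of the lineage folder, and the kernel: `norm_num`/`nlinarith` in leaves
  (16)–(18)).
* `quarterCovariance : QuarterCovariance`.  Proof: if `qp B = 0` it is `cov_pot_le_of_transverse`.  Else let
  `y qp B = |qp B|` (`|y| = 1`), `κ = 4|qp B| ≤ 4/3` (`abs_re_trace_su2_mul_le_opNorm`), `u⁰ = unitSU2 y`; the right
  translation `g ↦ g u⁰` (unimodularity of the compact group, `integral_mul_right_eq_self`) turns `pot B` into
  `κ x₀` and `pot Δ` into `4⟪d, x⟫`, `d = (y qp Δ)^*`, `|d| = |qp Δ|`, and keeps `φ` `L`-Lipschitz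
  (`suFrobDist_eq_sqrt_two_mul`).  Write `d = d′ + p`, `Re d′ = 0`.  Centring (`ν_B(pot Δ) = 4pZ′/Z`, the `d′`-part has
  mean zero by reflection symmetry) makes the centred observable the normal component `4⟪λ(x), x⟫` of leaf (19)'s field
  with `e = d′ + p(1 − κ²/20)`, `α = pκ²/20`, `β = −pZ′/Z`, whose sphere mean vanishes (`integral_inner_fluxField`);
  J-SC16f's Lipschitz–flux inequality `abs_integral_lipschitz_mul_inner_le`, leaf (21)'s `fluxRHS_eq` and `flux_bound`
  give `|Cov| ≤ (4/Z)·√2 L·(Z/4)|qp Δ| = √2 L |qp Δ| ≤ L‖Δ‖_F` (`sqrt_two_mul_norm_qp_le`).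
* the doors of `StrongCouplingQuarterCovariance`, now hypothesis-free: `su2_strongCouplingFront` (single-site
  Dobrushin front at every tree coupling `0 ≤ β₀ < 1/9`), `su2_dlrMassGapAt` (`DLRMassGapAt 4 2 (β_W/4)`) and
  `su2_latticeMassGap`, at every Wilson `0 ≤ β_W < 2/9 = 0.2222` — the ceiling of the single-site Dobrushin method
  (R21's no-go beyond it stands); the previously OWNED window was `β_W < √3/9 = 0.19245`.

HONEST FRAMING.  These doors are STRONG-COUPLING statements (high-temperature Dobrushin uniqueness of the lattice
theory, the classical Osterwalder–Seiler regime, made kernel-explicit on `0 ≤ β_W < 2/9`); nothing whatsoever is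
claimed at weak coupling, uniformly in `β`, or about a continuum limit: no mass-gap claim in the sense of the summit.
(v2 of the staged file: the two door docstrings' currency labels aligned with `UNITS.md` — SC-a = infinite-volume DLR, SC-b = torus front; nothing else changed.)
-/

noncomputable section

open MeasureTheory Filter Finset Real
open scoped NNReal Quaternion Matrix ComplexConjugate BigOperators Matrix.Norms.Frobenius ContDiff Topology
  RealInnerProductSpace

open Matrix Complex
open Literature.MathematicalPhysics.QuantumLattice (su2Quat quatMatrix quatMatrix_mul quatMatrix_su2Quat norm_su2Quat)
open Literature.MathematicalPhysics.QuantumFieldTheory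
open Literature.MathematicalPhysics.QuantumFieldTheory.SUNBakryEmery
open Literature.MathematicalPhysics.QuantumFieldTheory.Balaban1983to89.StrongCouplingVarianceWindow (qI qJ qK)
open Literature.MathematicalPhysics.QuantumLattice (fundamentalRep fundamentalLatticeRep)
open Literature.MathematicalPhysics.QuantumFieldTheory.Balaban1983to89
open Literature.MathematicalPhysics.QuantumFieldTheory.Balaban1983to89.StrongCouplingVarianceWindow
open Literature.MathematicalPhysics.QuantumFieldTheory.Balaban1983to89.StrongCouplingKernelWindow
open Literature.MathematicalPhysics.QuantumFieldTheory.Balaban1983to89.StrongCouplingDobrushinWindow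
open Literature.MathematicalPhysics.QuantumFieldTheory.Balaban1983to89.StrongCouplingTorusWindow
open Literature.MathematicalPhysics.QuantumFieldTheory.Balaban1983to89.StrongCouplingOpenWindow
open Literature.Probability.LatticeModels
open Summit.QuantumFields.BalabanUV.InfraRed.StrongCouplingSixFifthsVariance
open Summit.QuantumFields.BalabanUV.InfraRed.StrongCouplingReflection
open Summit.QuantumFields.BalabanUV.InfraRed.StrongCouplingTransverseMoment

namespace Summit.QuantumFields.BalabanUV.InfraRed.StrongCouplingFluxCovariance

open Summit.QuantumFields.BalabanUV.InfraRed.StrongCouplingSphereCalculus (radialDiv quatOfMat quatOfMat_coe)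
open Summit.QuantumFields.BalabanUV.InfraRed.StrongCouplingLipschitzFlux (abs_integral_lipschitz_mul_inner_le)
open Summit.QuantumFields.BalabanUV.InfraRed.StrongCouplingFluxField
open Summit.QuantumFields.BalabanUV.InfraRed.StrongCouplingFluxMoments
open Summit.QuantumFields.BalabanUV.InfraRed.StrongCouplingFluxLambda
open Summit.QuantumFields.BalabanUV.InfraRed.StrongCouplingCertArith (le_sqrt_mul_sqrt_of_forall add_mul_le_of_cert)
open Summit.QuantumFields.BalabanUV.InfraRed.StrongCouplingBallCertificate
open Summit.QuantumFields.BalabanUV.InfraRed.StrongCouplingQuarterCovariance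

/-! ## 1. The analytic inequality `|p|·Y + X ≤ (Z/4)·n` from the ball certificate -/

/-- **The flux inequality.**  For `0 < κ ≤ 4/3`, a purely imaginary `d'` and reals `p, n ≥ 0` with
`‖d'‖² + p² = n²`, the flux functional of the test field `W` of J-SC16i/§3n obeys `|p|·Y + X ≤ (Z/4)·n`, where
`Y`, `X` are the two ball integrals of `fluxRHS_eq`, via the λ-bounds (`Y ≤ √m₂ √H`, `X² ≤ z_B Q`), the expansions of
`H` and `Q` into ball moments, the certificate `ball_certificate` and the elementary `add_mul_le_of_cert`. [folklore] -/
theorem flux_bound {κ p n Z Zp zB m2 J41 J52 J61 J72 J63 J74 Y H X Q : ℝ} {d' : ℍ} (hκ0 : 0 < κ) (hκ1 : κ ≤ 4 / 3)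
    (hd' : d'.re = 0) (hn : ‖d'‖ ^ 2 + p ^ 2 = n ^ 2) (hn0 : 0 ≤ n)
    (hZ : Z = ∫ g, Real.exp (κ * (su2Quat g).re) ∂haarProbability (Matrix.specialUnitaryGroup (Fin 2) ℂ))
    (hZp : Zp = ∫ g, (su2Quat g).re * Real.exp (κ * (su2Quat g).re) ∂haarProbability (Matrix.specialUnitaryGroup (Fin 2) ℂ))
    (hzB : zB = ∫ r in (0:ℝ)..1, r ^ 3 * ∫ g, Real.exp (κ * r * (su2Quat g).re) ∂haarProbability (Matrix.specialUnitaryGroup (Fin 2) ℂ))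
    (hm2 : m2 = ∫ r in (0:ℝ)..1, r ^ 5 * ∫ g, Real.exp (κ * r * (su2Quat g).re) ∂haarProbability (Matrix.specialUnitaryGroup (Fin 2) ℂ))
    (hJ41 : J41 = ∫ r in (0:ℝ)..1, r ^ 4 * ∫ g, (su2Quat g).re * Real.exp (κ * r * (su2Quat g).re)
      ∂haarProbability (Matrix.specialUnitaryGroup (Fin 2) ℂ))
    (hJ52 : J52 = ∫ r in (0:ℝ)..1, r ^ 5 * ∫ g, (su2Quat g).re ^ 2 * Real.exp (κ * r * (su2Quat g).re)
      ∂haarProbability (Matrix.specialUnitaryGroup (Fin 2) ℂ))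
    (hJ61 : J61 = ∫ r in (0:ℝ)..1, r ^ 6 * ∫ g, (su2Quat g).re * Real.exp (κ * r * (su2Quat g).re)
      ∂haarProbability (Matrix.specialUnitaryGroup (Fin 2) ℂ))
    (hJ72 : J72 = ∫ r in (0:ℝ)..1, r ^ 7 * ∫ g, (su2Quat g).re ^ 2 * Real.exp (κ * r * (su2Quat g).re)
      ∂haarProbability (Matrix.specialUnitaryGroup (Fin 2) ℂ))
    (hJ63 : J63 = ∫ r in (0:ℝ)..1, r ^ 6 * ∫ g, (su2Quat g).re ^ 3 * Real.exp (κ * r * (su2Quat g).re)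
      ∂haarProbability (Matrix.specialUnitaryGroup (Fin 2) ℂ))
    (hJ74 : J74 = ∫ r in (0:ℝ)..1, r ^ 7 * ∫ g, (su2Quat g).re ^ 4 * Real.exp (κ * r * (su2Quat g).re)
      ∂haarProbability (Matrix.specialUnitaryGroup (Fin 2) ℂ))
    (hY : Y = ∫ r in (0:ℝ)..1, r ^ 4 * ∫ g, Real.exp (κ * r * (su2Quat g).re) *
      |(κ * (1 - κ ^ 2 / 20) - 4 * (Zp / Z)) + (κ ^ 2 / 4 - κ * (Zp / Z)) * (r * (su2Quat g).re) +
        (κ ^ 3 / 20) * (r * (su2Quat g).re) ^ 2| ∂haarProbability (Matrix.specialUnitaryGroup (Fin 2) ℂ))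
    (hH : H = ∫ r in (0:ℝ)..1, r ^ 3 * ∫ g, Real.exp (κ * r * (su2Quat g).re) *
      ((κ * (1 - κ ^ 2 / 20) - 4 * (Zp / Z)) + (κ ^ 2 / 4 - κ * (Zp / Z)) * (r * (su2Quat g).re) +
        (κ ^ 3 / 20) * (r * (su2Quat g).re) ^ 2) ^ 2 ∂haarProbability (Matrix.specialUnitaryGroup (Fin 2) ℂ))
    (hX : X = ∫ r in (0:ℝ)..1, r ^ 3 * ∫ g, Real.exp (κ * r * (su2Quat g).re) *
      ‖(d' + ((p * (1 - κ ^ 2 / 20) : ℝ) : ℍ)) + ((p * (κ ^ 2 / 20)) * (r * (su2Quat g).re) + -(p * (Zp / Z))) • (r • su2Quat g)‖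
      ∂haarProbability (Matrix.specialUnitaryGroup (Fin 2) ℂ))
    (hQ : Q = ∫ r in (0:ℝ)..1, r ^ 3 * ∫ g, Real.exp (κ * r * (su2Quat g).re) *
      ‖(d' + ((p * (1 - κ ^ 2 / 20) : ℝ) : ℍ)) + ((p * (κ ^ 2 / 20)) * (r * (su2Quat g).re) + -(p * (Zp / Z))) • (r • su2Quat g)‖ ^ 2
      ∂haarProbability (Matrix.specialUnitaryGroup (Fin 2) ℂ)) :
    |p| * Y + X ≤ Z / 4 * n := by
  -- the eleven-integral certificate and the rational brackets
  obtain ⟨hZl, hZu⟩ := Z_bracket hκ0.le hκ1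
  obtain ⟨hZpl, hZpu⟩ := Zp_bracket hκ0.le hκ1
  obtain ⟨hBl, hBu⟩ := zB_bracket hκ0.le hκ1
  rw [← hZ] at hZl hZu
  rw [← hZp] at hZpl hZpu
  rw [← hzB] at hBl hBu
  have hb := rational_brackets hκ0.le hκ1 hZl hZu hZpl hZpu hBl hBu
  have hZ1 : 1 ≤ Z := hb.1
  have hzBl : 1 / 4 ≤ zB := hb.2.2.2.2.1
  have hgap : κ ^ 2 / 25 ≤ Z - 4 * zB := hb.2.2.2.2.2.2.2.2.2.2
  have hzBpos : 0 < zB := by linarith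
  have hzBZ : zB < Z / 4 := by nlinarith
  have hcert := ball_certificate hκ0 hκ1 hZ hZp hzB hm2 hJ41 hJ52 hJ61 hJ72 hJ63 hJ74
  -- nonnegativity of the ball integrals
  have hY0 : 0 ≤ Y := by
    rw [hY]; exact ball_integral_nonneg (fun r g => mul_nonneg (Real.exp_pos _).le (abs_nonneg _)) 4
  have hm20 : 0 ≤ m2 := by rw [hm2]; exact ball_integral_nonneg (fun r g => (Real.exp_pos _).le) 5
  have hH0 : 0 ≤ H := by
    rw [hH]; exact ball_integral_nonneg (fun r g => mul_nonneg (Real.exp_pos _).le (sq_nonneg _)) 3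
  have hX0 : 0 ≤ X := by
    rw [hX]; exact ball_integral_nonneg (fun r g => mul_nonneg (Real.exp_pos _).le (norm_nonneg _)) 3
  have hQ0 : 0 ≤ Q := by
    rw [hQ]; exact ball_integral_nonneg (fun r g => mul_nonneg (Real.exp_pos _).le (sq_nonneg _)) 3
  -- `Y ≤ √m₂ √H` and the expansion of `H`
  have hYe : Y ≤ Real.sqrt m2 * Real.sqrt H := by
    refine le_sqrt_mul_sqrt_of_forall hm20 hH0 fun l hl => ?_
    have h := Y_le κ (κ * (1 - κ ^ 2 / 20) - 4 * (Zp / Z)) (κ ^ 2 / 4 - κ * (Zp / Z)) (κ ^ 3 / 20) hl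
    rw [← hY, ← hm2, ← hH] at h
    exact h
  have hHe : H = (κ * (1 - κ ^ 2 / 20) - 4 * (Zp / Z)) ^ 2 * zB +
      2 * (κ * (1 - κ ^ 2 / 20) - 4 * (Zp / Z)) * (κ ^ 2 / 4 - κ * (Zp / Z)) * J41 +
      ((κ ^ 2 / 4 - κ * (Zp / Z)) ^ 2 + 2 * (κ * (1 - κ ^ 2 / 20) - 4 * (Zp / Z)) * (κ ^ 3 / 20)) * J52 +
      2 * (κ ^ 2 / 4 - κ * (Zp / Z)) * (κ ^ 3 / 20) * J63 + (κ ^ 3 / 20) ^ 2 * J74 := by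
    have h := H_expand κ (κ * (1 - κ ^ 2 / 20) - 4 * (Zp / Z)) (κ ^ 2 / 4 - κ * (Zp / Z)) (κ ^ 3 / 20)
    rw [← hH, ← hzB, ← hJ41, ← hJ52, ← hJ63, ← hJ74] at h
    exact h
  -- `X² ≤ z_B Q` and the expansion of `Q`
  have hXe : X ≤ Real.sqrt zB * Real.sqrt Q := by
    refine le_sqrt_mul_sqrt_of_forall hzBpos.le hQ0 fun l hl => ?_
    have h := X_le κ (p * (κ ^ 2 / 20)) (-(p * (Zp / Z))) (d' + ((p * (1 - κ ^ 2 / 20) : ℝ) : ℍ)) hl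
    rw [← hX, ← hzB, ← hQ] at h
    exact h
  have hQe : Q = (‖d'‖ ^ 2 + (p * (1 - κ ^ 2 / 20)) ^ 2) * zB + 2 * (p * (1 - κ ^ 2 / 20)) * (-(p * (Zp / Z))) * J41 +
      2 * (p * (1 - κ ^ 2 / 20)) * (p * (κ ^ 2 / 20)) * J52 + (-(p * (Zp / Z))) ^ 2 * m2 +
      2 * (p * (κ ^ 2 / 20)) * (-(p * (Zp / Z))) * J61 + (p * (κ ^ 2 / 20)) ^ 2 * J72 := by
    have h := Q_expand κ (p * (κ ^ 2 / 20)) (-(p * (Zp / Z))) (p * (1 - κ ^ 2 / 20)) hd'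
    rw [← hQ, ← hzB, ← hJ41, ← hJ52, ← hm2, ← hJ61, ← hJ72] at h
    exact h
  have hX2 : X ^ 2 ≤ zB * ((n ^ 2 - |p| ^ 2) * zB + |p| ^ 2 * ((1 - κ ^ 2 / 20) ^ 2 * zB +
      2 * (1 - κ ^ 2 / 20) * (κ ^ 2 / 20) * J52 - 2 * (1 - κ ^ 2 / 20) * (Zp / Z) * J41 + (κ ^ 2 / 20) ^ 2 * J72 -
      2 * (κ ^ 2 / 20) * (Zp / Z) * J61 + (Zp / Z) ^ 2 * m2)) := by
    have h1 : X ^ 2 ≤ (Real.sqrt zB * Real.sqrt Q) ^ 2 := pow_le_pow_left₀ hX0 hXe 2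
    rw [mul_pow, Real.sq_sqrt hzBpos.le, Real.sq_sqrt hQ0, hQe] at h1
    have hd2 : ‖d'‖ ^ 2 = n ^ 2 - p ^ 2 := by linarith
    rw [hd2] at h1
    rw [sq_abs]
    refine h1.trans (le_of_eq ?_)
    ring
  -- `0 ≤ q_V` (it is the `Q` of the axial field `d' = 0`, `p = 1`)
  have hq0 : 0 ≤ (1 - κ ^ 2 / 20) ^ 2 * zB + 2 * (1 - κ ^ 2 / 20) * (κ ^ 2 / 20) * J52 -
      2 * (1 - κ ^ 2 / 20) * (Zp / Z) * J41 + (κ ^ 2 / 20) ^ 2 * J72 - 2 * (κ ^ 2 / 20) * (Zp / Z) * J61 +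
      (Zp / Z) ^ 2 * m2 := by
    have h := Q_expand κ (κ ^ 2 / 20) (-(Zp / Z)) (1 - κ ^ 2 / 20) (d' := 0) Quaternion.re_zero
    rw [← hzB, ← hJ41, ← hJ52, ← hm2, ← hJ61, ← hJ72, norm_zero] at h
    have h0 := ball_integral_nonneg (fun r (g : Matrix.specialUnitaryGroup (Fin 2) ℂ) => mul_nonneg (Real.exp_pos
      (κ * r * (su2Quat g).re)).le (sq_nonneg ‖((0 : ℍ) + (((1 - κ ^ 2 / 20) : ℝ) : ℍ)) +
        ((κ ^ 2 / 20) * (r * (su2Quat g).re) + -(Zp / Z)) • (r • su2Quat g)‖)) 3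
    rw [h] at h0
    refine h0.trans (le_of_eq ?_)
    ring
  -- the certificate in `add_mul_le_of_cert` form
  have hcert' : (Real.sqrt m2 * Real.sqrt H) ^ 2 * zB ≤ ((Z / 4) ^ 2 - zB ^ 2) * (zB - ((1 - κ ^ 2 / 20) ^ 2 * zB +
      2 * (1 - κ ^ 2 / 20) * (κ ^ 2 / 20) * J52 - 2 * (1 - κ ^ 2 / 20) * (Zp / Z) * J41 + (κ ^ 2 / 20) ^ 2 * J72 -
      2 * (κ ^ 2 / 20) * (Zp / Z) * J61 + (Zp / Z) ^ 2 * m2)) := by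
    rw [mul_pow, Real.sq_sqrt hm20, Real.sq_sqrt hH0, hHe]
    linarith
  have hpn : |p| ≤ n := by
    have h2 : p ^ 2 ≤ n ^ 2 := by linarith [sq_nonneg ‖d'‖]
    rw [← Real.sqrt_sq_eq_abs, ← Real.sqrt_sq hn0]
    exact Real.sqrt_le_sqrt h2
  rw [add_comm]
  exact add_mul_le_of_cert hzBpos hzBZ hq0 hcert' hX0 hX2 hY0 hYe (abs_nonneg p) hpn

/-! ## 2. `QuarterCovariance` -/

/-- `⟪↑c, x⟫ = c · Re x`. [folklore] -/
theorem inner_coe_left (c : ℝ) (x : ℍ) : ⟪(c : ℍ), x⟫ = c * x.re := by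
  rw [Quaternion.inner_def, Quaternion.re_mul]; simp

/-- `Re(x · ↑c) = Re x · c`. [folklore] -/
theorem re_mul_coe (x : ℍ) (c : ℝ) : (x * (c : ℍ)).re = x.re * c := by
  rw [Quaternion.re_mul]; simp

/-- **Theorem (J-SC16i).**  `QuarterCovariance` holds: for every `B` in the Dobrushin ball `‖B‖_op ≤ 1/3`, every `Δ`, and
every bounded measurable `φ` that is `L`-Lipschitz for the Frobenius distance on `SU(2)`,
`|Cov_{ν_B}(φ, 2 Re tr(· Δ))| ≤ L ‖Δ‖_F`, `ν_B = σ.tilted (2 Re tr(· B))`.  Proof: rotate the tilt axis to `1`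
(right translation by the unit `u⁰`, `x_{u⁰} qp B = |qp B|`), centre, write the centred observable as the normal
component `4⟪λ(x), x⟫` of the divergence-managed test field `λ` (`integral_inner_fluxField` fixes the constant so that
`σ(⟪λ, x⟫) = 0`), apply the Lipschitz–flux inequality `abs_integral_lipschitz_mul_inner_le`, evaluate the flux side
by `fluxRHS_eq`, and close with `flux_bound`.  For `qp B = 0` it is `cov_pot_le_of_transverse`. [folklore] -/
theorem quarterCovariance : QuarterCovariance := by
  intro B Δ hB φ L hφm hφb hL hφL
  by_cases hm : qp B = 0
  · exact cov_pot_le_of_transverse B Δ (by rw [hm, star_zero, mul_zero, Quaternion.re_zero]) hφm hφb hL hφL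
  obtain ⟨C, hC⟩ := hφb
  obtain ⟨y, hy1, hy⟩ := exists_unit_mul_eq_norm (qp B)
  have hmpos : 0 < ‖qp B‖ := norm_pos_iff.2 hm
  obtain ⟨κ, hκ⟩ : ∃ κ : ℝ, κ = 4 * ‖qp B‖ := ⟨_, rfl⟩
  have hκ0 : 0 < κ := by rw [hκ]; positivity
  obtain ⟨u0, hu0def⟩ : ∃ u : Matrix.specialUnitaryGroup (Fin 2) ℂ, u = unitSU2 y hy1 := ⟨_, rfl⟩
  have hu0 : su2Quat u0 = y := by rw [hu0def]; exact su2Quat_unitSU2 y hy1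
  -- `κ ≤ 4/3` from the Dobrushin ball
  have hκ1 : κ ≤ 4 / 3 := by
    have h1 := abs_re_trace_su2_mul_le_opNorm u0 B
    have h2 : pot B u0 = 2 * ((u0 : Matrix (Fin 2) (Fin 2) ℂ) * B).trace.re := rfl
    have h3 : pot B u0 = κ := by rw [pot_eq, hu0, hy, Quaternion.re_coe, hκ]
    have h4 := le_abs_self (((u0 : Matrix (Fin 2) (Fin 2) ℂ) * B).trace.re)
    linarith
  -- the potentials after the right rotation by `u⁰`
  have hpotB : ∀ g, pot B (g * u0) = κ * (su2Quat g).re := fun g => by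
    rw [pot_eq, su2Quat_mul, hu0, mul_assoc, hy, re_mul_coe, hκ]; ring
  obtain ⟨d, hd⟩ : ∃ d : ℍ, d = star (y * qp Δ) := ⟨_, rfl⟩
  have hpotΔ : ∀ g, pot Δ (g * u0) = 4 * ⟪d, su2Quat g⟫ := fun g => by
    rw [pot_eq, su2Quat_mul, hu0, mul_assoc, hd, Quaternion.inner_def, ← star_mul, Quaternion.re_star]
  have hnd : ‖d‖ = ‖qp Δ‖ := by rw [hd, norm_star, norm_mul, hy1, one_mul]
  obtain ⟨p, hp⟩ : ∃ p : ℝ, p = d.re := ⟨_, rfl⟩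
  obtain ⟨d', hd'⟩ : ∃ d' : ℍ, d' = d - (p : ℍ) := ⟨_, rfl⟩
  have hd're : d'.re = 0 := by rw [hd', Quaternion.re_sub, Quaternion.re_coe, hp, sub_self]
  have hdd : d = d' + (p : ℍ) := by rw [hd', sub_add_cancel]
  have hn2 : ‖d'‖ ^ 2 + p ^ 2 = ‖qp Δ‖ ^ 2 := by
    have h := norm_sq_affine d' hd're p 0 1 norm_one
    rw [zero_smul, add_zero, ← hdd, hnd] at h
    linarith
  have hdx : ∀ g, ⟪d, su2Quat g⟫ = ⟪d', su2Quat g⟫ + p * (su2Quat g).re := fun g => by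
    rw [hdd, inner_add_left, inner_coe_left]
  -- the two normalising moments
  obtain ⟨Z, hZ⟩ : ∃ Z : ℝ, Z = ∫ g, Real.exp (κ * (su2Quat g).re)
    ∂haarProbability (Matrix.specialUnitaryGroup (Fin 2) ℂ) := ⟨_, rfl⟩
  obtain ⟨Zp, hZp⟩ : ∃ Zp : ℝ, Zp = ∫ g, (su2Quat g).re * Real.exp (κ * (su2Quat g).re)
    ∂haarProbability (Matrix.specialUnitaryGroup (Fin 2) ℂ) := ⟨_, rfl⟩
  have hexpF := integrable_exp_pot B
  have hZrot : ∫ s, Real.exp (pot B s) ∂haarProbability (Matrix.specialUnitaryGroup (Fin 2) ℂ) = Z := by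
    have h := integral_mul_right_eq_self (μ := haarProbability (Matrix.specialUnitaryGroup (Fin 2) ℂ))
      (fun s : Matrix.specialUnitaryGroup (Fin 2) ℂ => Real.exp (pot B s)) u0
    simp only [hpotB] at h
    rw [hZ, ← h]
  have hZpos : 0 < Z := by rw [← hZrot]; exact integral_exp_pos hexpF
  have hZne : Z ≠ 0 := hZpos.ne'
  -- the tilted law: integrability and centring
  haveI : IsProbabilityMeasure ((haarProbability (Matrix.specialUnitaryGroup (Fin 2) ℂ)).tilted (pot B)) :=
    isProbabilityMeasure_tilted hexpF
  have hpm : Measurable (pot Δ) := (continuous_pot Δ).measurable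
  have hφi : Integrable φ ((haarProbability (Matrix.specialUnitaryGroup (Fin 2) ℂ)).tilted (pot B)) :=
    integrable_of_measurable_of_abs_le hφm hC
  have hφpi : Integrable (fun s => φ s * pot Δ s) ((haarProbability (Matrix.specialUnitaryGroup (Fin 2) ℂ)).tilted (pot B)) :=
    integrable_of_measurable_of_abs_le (hφm.mul hpm) (C := C * (2 * (Real.sqrt 2 * frobNorm Δ))) fun s => by
      rw [abs_mul]; exact mul_le_mul (hC s) (abs_pot_le Δ s) (abs_nonneg _) ((abs_nonneg _).trans (hC s))
  obtain ⟨E3, hE3⟩ : ∃ E : ℝ, E = ∫ s, pot Δ s ∂((haarProbability (Matrix.specialUnitaryGroup (Fin 2) ℂ)).tilted (pot B)) :=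
    ⟨_, rfl⟩
  have hc1 : ∫ s, φ s * pot Δ s ∂((haarProbability (Matrix.specialUnitaryGroup (Fin 2) ℂ)).tilted (pot B)) -
      (∫ s, φ s ∂((haarProbability (Matrix.specialUnitaryGroup (Fin 2) ℂ)).tilted (pot B))) *
        ∫ s, pot Δ s ∂((haarProbability (Matrix.specialUnitaryGroup (Fin 2) ℂ)).tilted (pot B)) =
      ∫ s, φ s * (pot Δ s - E3) ∂((haarProbability (Matrix.specialUnitaryGroup (Fin 2) ℂ)).tilted (pot B)) := by
    have h : ∫ s, φ s * (pot Δ s - E3) ∂((haarProbability (Matrix.specialUnitaryGroup (Fin 2) ℂ)).tilted (pot B)) =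
        ∫ s, φ s * pot Δ s ∂((haarProbability (Matrix.specialUnitaryGroup (Fin 2) ℂ)).tilted (pot B)) -
        ∫ s, E3 * φ s ∂((haarProbability (Matrix.specialUnitaryGroup (Fin 2) ℂ)).tilted (pot B)) := by
      rw [← integral_sub hφpi (hφi.const_mul E3)]
      refine integral_congr_ae (ae_of_all _ fun s => ?_)
      ring
    rw [h, integral_const_mul, ← hE3]
    ring
  -- the mean `E₃ = ν_B(pot Δ) = 4 p Z′/Z`
  have hq1 : Continuous fun g : Matrix.specialUnitaryGroup (Fin 2) ℂ => su2Quat g := by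
    have h : Continuous fun g : Matrix.specialUnitaryGroup (Fin 2) ℂ => quatOfMat (g : Matrix (Fin 2) (Fin 2) ℂ) :=
      (LinearMap.continuous_of_finiteDimensional quatOfMat).comp continuous_subtype_val
    simpa only [quatOfMat_coe] using h
  have hq : Continuous fun g : Matrix.specialUnitaryGroup (Fin 2) ℂ => (su2Quat g).re := Quaternion.continuous_re.comp hq1
  have hE3' : E3 = 4 * p * Zp / Z := by
    rw [hE3, integral_tilted]
    simp_rw [smul_eq_mul, div_mul_eq_mul_div]
    rw [integral_div, hZrot]
    have h := integral_mul_right_eq_self (μ := haarProbability (Matrix.specialUnitaryGroup (Fin 2) ℂ))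
      (fun s : Matrix.specialUnitaryGroup (Fin 2) ℂ => Real.exp (pot B s) * pot Δ s) u0
    simp only [hpotB, hpotΔ, hdx] at h
    rw [← h]
    have i1 : Integrable (fun g : Matrix.specialUnitaryGroup (Fin 2) ℂ => ⟪d', su2Quat g⟫ * Real.exp (κ * (su2Quat g).re))
        (haarProbability (Matrix.specialUnitaryGroup (Fin 2) ℂ)) := integrable_of_continuous_SUN (by fun_prop) _
    have i2 : Integrable (fun g : Matrix.specialUnitaryGroup (Fin 2) ℂ => (su2Quat g).re * Real.exp (κ * (su2Quat g).re))
        (haarProbability (Matrix.specialUnitaryGroup (Fin 2) ℂ)) := integrable_of_continuous_SUN (by fun_prop) _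
    have i12 : Integrable (fun g : Matrix.specialUnitaryGroup (Fin 2) ℂ => 4 * (⟪d', su2Quat g⟫ * Real.exp (κ * (su2Quat g).re)) +
        4 * p * ((su2Quat g).re * Real.exp (κ * (su2Quat g).re))) (haarProbability (Matrix.specialUnitaryGroup (Fin 2) ℂ)) :=
      (i1.const_mul _).add (i2.const_mul _)
    have e : ∫ g, Real.exp (κ * (su2Quat g).re) * (4 * (⟪d', su2Quat g⟫ + p * (su2Quat g).re))
        ∂haarProbability (Matrix.specialUnitaryGroup (Fin 2) ℂ) =
        4 * (∫ g, ⟪d', su2Quat g⟫ * Real.exp (κ * (su2Quat g).re) ∂haarProbability (Matrix.specialUnitaryGroup (Fin 2) ℂ)) +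
        4 * p * ∫ g, (su2Quat g).re * Real.exp (κ * (su2Quat g).re) ∂haarProbability (Matrix.specialUnitaryGroup (Fin 2) ℂ) := by
      rw [← integral_const_mul, ← integral_const_mul, ← integral_add (i1.const_mul _) (i2.const_mul _)]
      refine integral_congr_ae (ae_of_all _ fun g => ?_)
      ring
    have h0' := integral_inner_mul_eq_zero hd're (fun t => Real.exp (κ * t))
    beta_reduce at h0'
    rw [e, h0', ← hZp]
    ring
  -- Lipschitz transport of `φ` along the rotation
  have hψL : ∀ a b : Matrix.specialUnitaryGroup (Fin 2) ℂ, |φ (a * u0) - φ (b * u0)| ≤ L * suFrobDist a b := fun a b => by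
    have h := hφL (a * u0) (b * u0)
    rwa [suFrobDist_eq_sqrt_two_mul, su2Quat_mul, su2Quat_mul, hu0, ← sub_mul, norm_mul, hy1, mul_one,
      ← suFrobDist_eq_sqrt_two_mul] at h
  -- the centred observable is the normal component of the test field `λ`, and `σ(⟪λ, x⟫) = 0`
  have h0 : ∫ g, ⟪Real.exp (κ * (su2Quat g).re) • ((d' + ((p * (1 - κ ^ 2 / 20) : ℝ) : ℍ)) +
      ((p * (κ ^ 2 / 20)) * (su2Quat g).re + -(p * (Zp / Z))) • su2Quat g), su2Quat g⟫
      ∂haarProbability (Matrix.specialUnitaryGroup (Fin 2) ℂ) = 0 := by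
    rw [integral_inner_fluxField κ hd're (p * (1 - κ ^ 2 / 20)) (p * (κ ^ 2 / 20)) (-(p * (Zp / Z))), ← hZ, ← hZp]
    field_simp
    ring
  have hnum : ∫ s, Real.exp (pot B s) * (φ s * (pot Δ s - E3)) ∂haarProbability (Matrix.specialUnitaryGroup (Fin 2) ℂ) =
      4 * ∫ g, φ (g * u0) * ⟪Real.exp (κ * (su2Quat g).re) • ((d' + ((p * (1 - κ ^ 2 / 20) : ℝ) : ℍ)) +
        ((p * (κ ^ 2 / 20)) * (su2Quat g).re + -(p * (Zp / Z))) • su2Quat g), su2Quat g⟫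
        ∂haarProbability (Matrix.specialUnitaryGroup (Fin 2) ℂ) := by
    have h := integral_mul_right_eq_self (μ := haarProbability (Matrix.specialUnitaryGroup (Fin 2) ℂ))
      (fun s : Matrix.specialUnitaryGroup (Fin 2) ℂ => Real.exp (pot B s) * (φ s * (pot Δ s - E3))) u0
    simp only [hpotB, hpotΔ, hdx] at h
    rw [← h, ← integral_const_mul]
    refine integral_congr_ae (ae_of_all _ fun g => ?_)
    beta_reduce
    rw [inner_fluxField, norm_su2Quat, one_pow, mul_one, inner_add_left, inner_coe_left, hE3']
    field_simp
    ring
  -- the Lipschitz–flux inequality and the evaluation of the flux side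
  have h15 := abs_integral_lipschitz_mul_inner_le (φ := fun g => φ (g * u0)) hL hψL
    (contDiff_fluxField κ (d' + ((p * (1 - κ ^ 2 / 20) : ℝ) : ℍ)) (p * (κ ^ 2 / 20)) (-(p * (Zp / Z)))) h0
  beta_reduce at h15
  have hc : ∀ t : ℝ, 4 * (-(p * (Zp / Z))) + κ * (d' + ((p * (1 - κ ^ 2 / 20) : ℝ) : ℍ)).re +
      (5 * (p * (κ ^ 2 / 20)) + κ * (-(p * (Zp / Z)))) * t + κ * (p * (κ ^ 2 / 20)) * t ^ 2 =
      p * ((κ * (1 - κ ^ 2 / 20) - 4 * (Zp / Z)) + (κ ^ 2 / 4 - κ * (Zp / Z)) * t + (κ ^ 3 / 20) * t ^ 2) := fun t => by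
    rw [Quaternion.re_add, hd're, Quaternion.re_coe]; ring
  rw [fluxRHS_eq κ (p * (κ ^ 2 / 20)) (-(p * (Zp / Z))) p (κ * (1 - κ ^ 2 / 20) - 4 * (Zp / Z))
    (κ ^ 2 / 4 - κ * (Zp / Z)) (κ ^ 3 / 20) (d' + ((p * (1 - κ ^ 2 / 20) : ℝ) : ℍ)) hc] at h15
  have hfb := flux_bound hκ0 hκ1 hd're hn2 (norm_nonneg (qp Δ)) hZ hZp rfl rfl rfl rfl rfl rfl rfl rfl rfl rfl rfl rfl
  -- assembly
  rw [hc1, integral_tilted]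
  simp_rw [smul_eq_mul, div_mul_eq_mul_div]
  rw [integral_div, hZrot, hnum, abs_div, abs_of_pos hZpos, div_le_iff₀ hZpos, abs_mul,
    abs_of_pos (by norm_num : (0:ℝ) < 4)]
  have hs := sqrt_two_mul_norm_qp_le Δ
  have h2L : 0 ≤ Real.sqrt 2 * L := mul_nonneg (Real.sqrt_nonneg _) hL
  calc 4 * |∫ g, φ (g * u0) * ⟪Real.exp (κ * (su2Quat g).re) • ((d' + ((p * (1 - κ ^ 2 / 20) : ℝ) : ℍ)) +
        ((p * (κ ^ 2 / 20)) * (su2Quat g).re + -(p * (Zp / Z))) • su2Quat g), su2Quat g⟫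
        ∂haarProbability (Matrix.specialUnitaryGroup (Fin 2) ℂ)|
      ≤ 4 * (Real.sqrt 2 * L * (Z / 4 * ‖qp Δ‖)) := by
        have := mul_le_mul_of_nonneg_left hfb h2L
        linarith
    _ = (Real.sqrt 2 * ‖qp Δ‖) * L * Z := by ring
    _ ≤ frobNorm Δ * L * Z := mul_le_mul_of_nonneg_right (mul_le_mul_of_nonneg_right hs hL) hZpos.le
    _ = L * frobNorm Δ * Z := by ring

/-! ## 3. The hypothesis-free doors at Wilson `β_W < 2/9` -/

/-- **Door (SC-b: torus front), hypothesis-free.**  The single-site Dobrushin front of `SU(2)` at every tree coupling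
`0 ≤ β₀ < 1/9` (Wilson `β_W < 2/9 = 0.2222`). [folklore] -/
theorem su2_strongCouplingFront {β₀W : ℝ} (h0 : 0 ≤ β₀W) (hlt : β₀W < 2 / 9) :
    CrossoverLedger.StrongCouplingFront (fundamentalLatticeRep 2) (β₀W / 2) :=
  su2_strongCouplingFront_of_quarterCovariance quarterCovariance h0 hlt

/-- **Door (SC-a: infinite-volume DLR), hypothesis-free.**  The DLR mass gap of `SU(2)`, `d = 4`, at every Wilson `0 ≤ β_W < 2/9`
('t Hooft `β_W/4`). [folklore] -/
theorem su2_dlrMassGapAt {βW : ℝ} (h0 : 0 ≤ βW) (hlt : βW < 2 / 9) : DLRMassGapAt 4 2 (βW / 4) :=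
  su2_dlrMassGapAt_of_quarterCovariance quarterCovariance h0 hlt

/-- **Door (SC-c), hypothesis-free.**  The ledger's `LatticeMassGap` currency at every Wilson `0 ≤ β_W < 2/9`.
[folklore] -/
theorem su2_latticeMassGap {βW : ℝ} (h0 : 0 ≤ βW) (hlt : βW < 2 / 9) :
    CrossoverLedger.LatticeMassGap (fundamentalRep (Fin 2)) (βW / 2) (krRate (18 * βW * (1 / 4))) :=
  su2_latticeMassGap_of_quarterCovariance quarterCovariance h0 hlt

end Summit.QuantumFields.BalabanUV.InfraRed.StrongCouplingFluxCovariance
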